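import Literature.MathematicalPhysics.QuantumFieldTheory.Balaban1983to89.B9Eq38CrossLettersL2
import Literature.MathematicalPhysics.QuantumFieldTheory.Balaban1983to89.B9Eq370SecondOrderConversionL2

/-!
# `Balaban1983to89.B9Eq38SecondOrderCrossL2` — «we may always replace ∇_U by ∇*_U, and vice versa» (p. 398) for the SECOND-ORDER (3.46) members,
# in the block-`ℓ²` currency: the INNER orientation switch `∇_μ∇_νG ↦ ∇_μ∇*_νG`, `G∇*_μ∇*_ν ↦ G∇_μ∇*_ν` costs the commutator of the two transport-shifts,
# i.e. the plaquette of the configuration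

T. Bałaban, *Propagators for lattice gauge theories in a background field*, Commun. Math. Phys. **99** (1985) 389–434
[`Balaban1985BackgroundPropagators`, "B9"]; [4] = T. Bałaban, *Propagators and renormalization transformations for lattice gauge
theories. II*, Commun. Math. Phys. **96** (1984) 223–250 [`Balaban1984PropagatorsII`].

statement-level skeleton of published theorems with citation tags; proofs where landed; nothing here is a claim about the
Yang–Mills mass gap

THE PRINTED LOCI.  p. 398, first remark after Theorem 3.1 («we may always replace ∇_U by ∇*_U, and vice versa, using (3.8)»); (3.8) p. 392, (3.5) p. 391,
(3.3) p. 390 (`∇*_μ = −τ*_μ∇_μ`, `∇_μ = −∇*_μτ_μ` with the transport-shifts `τ_μ`, `τ*_μ` of `B9Eq38CrossLettersL2`); Theorem 3.1 (3.46) p. 398 (members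
`∇_U∇_UG`, `G∇*_U∇*_U`, weights `1`); p. 404 after (3.69) (the plaquette smallness `|U(∂p) − 1| ≦ O(1)(Mα₀ + α₁)ξ²` of the configurations in play, here a
DISPLAYED hypothesis `hplaq` on the transports); [4] Prop. 2.6 (2.140)–(2.141) p. 247, Lemma 2.1 p. 234.

WHY THIS FILE (pub-ymgap N06 row 13, seat dag-n06-c gen 9).  `B9Eq38CrossLettersL2` switches the orientation of an OUTER difference letter for free
(`∇♯_{inr μ}·X = τ*_μ·(∇♯_{inl μ}·X)`, `X·∇♯_{inl μ} = (X·∇♯_{inr μ})·τ_μ`).  For the INNER letter of a second difference, `∇_μ∇*_νG = ∇_μτ*_ν∇_νG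
= τ*_ν(∇_μ∇_νG) + [∇_μ, τ*_ν](∇_νG)` and `G∇_μ∇*_ν = G∇*_μτ_μ∇*_ν = (G∇*_μ∇*_ν)τ_μ + (G∇*_μ)[τ_μ, ∇*_ν]`, and both commutators are `±η⁻¹[τ_μ, τ*_ν]`,
the commutator of the two transport-shifts: a local letter reading ONE neighbour `x + e_μ − e_ν` whose value is the difference of the two transports around
the plaquette at `x − e_ν`, of size `ρ⁴·c_P(η/ℓ)²` under the plaquette smallness — so `η⁻¹[τ_μ, τ*_ν]` has weight `c_Pρ⁴·ηℓ⁻²`, and composed with the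
(3.46) entries `∇_νG`, `G∇*_μ` (weight `ℓ`) gives weight `ηℓ⁻¹ ≦ 1` ([4] (2.141)).  §1: the commutator pointwise and as a block-`ℓ²` letter ([4] (2.140),
multiplicity one, stencil `2d₀`, the size read at `x − e_ν` and brought to `y(x)` by a one-step scale comparability `σ₁`); §2: the two INNER conversions
for any `Gp` and any configuration with transports `≦ ρ` (the base `U`, `ρ = 1`, or `U′U`, `ρ = e^{1/4}`).  Together with `B9Eq38CrossLettersL2` this
gives every orientation pattern of the second-order members from print's `∇∇G`, `G∇*∇*` (and `∇G`, `G∇*`).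
Value = bookkeeping of one remark of print at second order; NOT summit progress; N06 is not discharged by this file.
-/

noncomputable section

namespace Literature.MathematicalPhysics.QuantumFieldTheory.Balaban1983to89.B9Eq38SecondOrderCrossL2

open NormedSpace Complex
open Literature.MathematicalPhysics.QuantumFieldTheory.Balaban1983to89
open Literature.MathematicalPhysics.QuantumFieldTheory.Balaban1983to89.B6RandomWalk (Triangle254 Ineq261)
open Literature.MathematicalPhysics.QuantumFieldTheory.Balaban1983to89.B6RandomWalkL2 (HasL2Majorant hasL2Majorant_mono hasL2Majorant_add)
open Literature.MathematicalPhysics.QuantumFieldTheory.Balaban1983to89.B9Thm34Ext (toB6)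
open Literature.MathematicalPhysics.QuantumFieldTheory.Balaban1983to89.B9Ineq347 (ScaleTransfer)
open Literature.MathematicalPhysics.QuantumFieldTheory.Balaban1983to89.B9Eq39Adjoint (R R_def R_mul R_sub R_smul R_inv_R covD covDstar)
open Literature.MathematicalPhysics.QuantumFieldTheory.Balaban1983to89.B9Eq352DivFormLetters (conj conj_sub conj_mul gradLetterF_apply gradLetterB_apply)
open Literature.MathematicalPhysics.QuantumFieldTheory.Balaban1983to89.B9Eq352GradLetters (diffLetter diffLetter_inl diffLetter_inr)
open Literature.MathematicalPhysics.QuantumFieldTheory.Balaban1983to89.B9Ineq363L2 (hasL2Majorant_comp_decay hasL2Majorant_rate_mono)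
open Literature.MathematicalPhysics.QuantumFieldTheory.Balaban1983to89.B9Eq38CrossLettersL2 (shiftFLetter shiftBLetter shiftFLetter_apply shiftBLetter_apply
  diffLetter_inr_eq_shiftB_mul diffLetter_inl_eq_mul_shiftF hasL2Majorant_shiftFLetter hasL2Majorant_shiftBLetter)
open Literature.MathematicalPhysics.QuantumFieldTheory.Balaban1983to89.B9Eq370SecondOrderConversionL2 (hasL2Majorant_conj_of_oneNeighbour_w
  norm_inv_smul' le_of_scaleTransfer)

/-! ## §1  The commutator of the two transport-shifts: the plaquette of the configuration -/

section Commutator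

variable {𝔸 : Type*} [NormedRing 𝔸] [NormedAlgebra ℂ 𝔸] [CompleteSpace 𝔸] {ι : Type} [Fintype ι] [DecidableEq ι]
variable (b : Module.Basis ι ℝ 𝔸) {S : Type} [Fintype S] [DecidableEq S] {κ : Type}
variable (T : κ → Equiv.Perm S) (V : κ → S → 𝔸ˣ)

omit [CompleteSpace 𝔸] [Fintype ι] [DecidableEq ι] [Fintype S] [DecidableEq S] in
/-- **`[τ_μ, τ*_ν]` WRITTEN OUT**: `([τ_μ, τ*_ν]Φ)(x) = R(V_μ(x))R(V_ν(x+e_μ−e_ν))⁻¹Φ(x+e_μ−e_ν) − R(V_ν(x−e_ν))⁻¹R(V_μ(x−e_ν))Φ(x−e_ν+e_μ)`.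
[cite: Balaban1985BackgroundPropagators, (3.5) p.391, (3.3) p.390] -/
theorem comm_shift_apply (μ ν : κ) (Φ : S → 𝔸) (x : S) :
    (shiftFLetter T V μ * shiftBLetter T V ν - shiftBLetter T V ν * shiftFLetter T V μ) Φ x
      = R (V μ x) (R (V ν ((T ν).symm (T μ x)))⁻¹ (Φ ((T ν).symm (T μ x))))
        - R (V ν ((T ν).symm x))⁻¹ (R (V μ ((T ν).symm x)) (Φ (T μ ((T ν).symm x)))) := by
  rw [LinearMap.sub_apply, Pi.sub_apply, Module.End.mul_apply, Module.End.mul_apply, shiftFLetter_apply, shiftBLetter_apply, shiftBLetter_apply,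
    shiftFLetter_apply]

omit [CompleteSpace 𝔸] [Fintype ι] [DecidableEq ι] [Fintype S] [DecidableEq S] in
/-- **`[∇♯_{inl μ}, τ*_ν] = c·[τ_μ, τ*_ν]` pointwise** (`∇♯_{inl μ} = c(τ_μ − 1)`). [cite: Balaban1985BackgroundPropagators, (3.3) p.390, (3.5) p.391] -/
theorem comm_diffLetter_inl_shiftB_apply (c : ℂ) (μ ν : κ) (Φ : S → 𝔸) (x : S) :
    (diffLetter T V c (Sum.inl μ) * shiftBLetter T V ν - shiftBLetter T V ν * diffLetter T V c (Sum.inl μ)) Φ x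
      = c • ((shiftFLetter T V μ * shiftBLetter T V ν - shiftBLetter T V ν * shiftFLetter T V μ) Φ x) := by
  rw [comm_shift_apply]
  simp only [LinearMap.sub_apply, Pi.sub_apply, Module.End.mul_apply, diffLetter_inl, gradLetterF_apply, shiftBLetter_apply, covD,
    R_sub, R_smul, smul_sub]
  abel

omit [CompleteSpace 𝔸] [Fintype ι] [DecidableEq ι] [Fintype S] [DecidableEq S] in
/-- **`[τ_μ, ∇♯_{inr ν}] = −c·[τ_μ, τ*_ν]` pointwise** (`∇♯_{inr ν} = −c(τ*_ν − 1)`). [cite: Balaban1985BackgroundPropagators, (3.8) p.392, (3.5) p.391] -/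
theorem comm_shiftF_diffLetter_inr_apply (c : ℂ) (μ ν : κ) (Φ : S → 𝔸) (x : S) :
    (shiftFLetter T V μ * diffLetter T V c (Sum.inr ν) - diffLetter T V c (Sum.inr ν) * shiftFLetter T V μ) Φ x
      = -(c • ((shiftFLetter T V μ * shiftBLetter T V ν - shiftBLetter T V ν * shiftFLetter T V μ) Φ x)) := by
  rw [comm_shift_apply]
  simp only [LinearMap.sub_apply, Pi.sub_apply, Module.End.mul_apply, diffLetter_inr, LinearMap.neg_apply, Pi.neg_apply, gradLetterB_apply,
    shiftFLetter_apply, covDstar, R_sub, R_smul, smul_sub, neg_sub]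
  abel

variable {g : B9.Geometry}

omit [CompleteSpace 𝔸] [Fintype ι] [DecidableEq ι] [Fintype S] [DecidableEq S] in
/-- ★ **THE SHIFT COMMUTATOR IS THE PLAQUETTE**: with `y = x − e_ν` and commuting shifts (`y + e_μ = (x + e_μ) − e_ν`), transports `‖V‖, ‖V⁻¹‖ ≦ ρ` and the
plaquette smallness at `y` in the transported form `‖R(V_μ(y)V_ν(y+e_μ))X − R(V_ν(y)V_μ(y+e_ν))X‖ ≦ c_P(η/ℓ(y(y)))²‖X‖`:
`‖([τ_μ, τ*_ν]Φ)(x)‖ ≦ ρ⁴c_P(η/ℓ(y(x−e_ν)))²·‖Φ(x+e_μ−e_ν)‖` — the two products are `R(V_ν(y))⁻¹R(V(∂p)-paths)R(V_ν(y+e_μ))⁻¹`.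
[cite: Balaban1985BackgroundPropagators, p.398 (first remark), p.404 after (3.69)] -/
theorem norm_comm_shift_apply_le (blk : S → g.Site) {η ρ cP : ℝ} (hcP : 0 ≤ cP) (μ ν : κ) (x : S)
    (hcomm : T μ ((T ν).symm x) = (T ν).symm (T μ x))
    (hρ : ∀ κ' y, ‖((V κ' y : 𝔸ˣ) : 𝔸)‖ ≤ ρ ∧ ‖(((V κ' y)⁻¹ : 𝔸ˣ) : 𝔸)‖ ≤ ρ)
    (hplaq : ∀ X : 𝔸, ‖R (V μ ((T ν).symm x) * V ν (T μ ((T ν).symm x))) X - R (V ν ((T ν).symm x) * V μ (T ν ((T ν).symm x))) X‖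
      ≤ cP * (η * (g.len (blk ((T ν).symm x)))⁻¹) ^ 2 * ‖X‖) (Φ : S → 𝔸) :
    ‖(shiftFLetter T V μ * shiftBLetter T V ν - shiftBLetter T V ν * shiftFLetter T V μ) Φ x‖
      ≤ ρ ^ 4 * (cP * (η * (g.len (blk ((T ν).symm x)))⁻¹) ^ 2) * ‖Φ ((T ν).symm (T μ x))‖ := by
  rw [comm_shift_apply, hcomm]
  have hρ0 : 0 ≤ ρ := (norm_nonneg _).trans (hρ μ x).1
  rw [Equiv.apply_symm_apply, hcomm] at hplaq
  generalize hy : (T ν).symm x = y at hplaq ⊢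
  generalize hy' : (T ν).symm (T μ x) = y' at hplaq ⊢
  have hx : T ν y = x := by rw [← hy, Equiv.apply_symm_apply]
  -- the two paths through `R(V_ν(y))⁻¹ · R(path) · R(V_ν(y′))⁻¹`
  have h1 : V μ x * (V ν y')⁻¹ = (V ν y)⁻¹ * (V ν y * V μ x) * (V ν y')⁻¹ := by group
  have h2 : (V ν y)⁻¹ * V μ y = (V ν y)⁻¹ * (V μ y * V ν y') * (V ν y')⁻¹ := by group
  have e : R (V μ x) (R (V ν y')⁻¹ (Φ y')) - R (V ν y)⁻¹ (R (V μ y) (Φ y'))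
      = R (V ν y)⁻¹ (R (V ν y * V μ x) (R (V ν y')⁻¹ (Φ y')) - R (V μ y * V ν y') (R (V ν y')⁻¹ (Φ y'))) := by
    rw [← B9Eq39Adjoint.R_mul, ← B9Eq39Adjoint.R_mul, h1, h2]
    simp only [B9Eq39Adjoint.R_mul, R_sub, R_inv_R]
  rw [e, ← hx]
  rw [← hx] at hplaq
  have hQ : ‖R (V ν y')⁻¹ (Φ y')‖ ≤ ρ ^ 2 * ‖Φ y'‖ :=
    B9Eq371Composition.norm_R_le_sq (V ν y')⁻¹ (hρ ν y').2 (by rw [inv_inv]; exact (hρ ν y').1) _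
  have hp := hplaq (R (V ν y')⁻¹ (Φ y'))
  rw [norm_sub_rev] at hp
  calc ‖R (V ν y)⁻¹ (R (V ν y * V μ (T ν y)) (R (V ν y')⁻¹ (Φ y')) - R (V μ y * V ν y') (R (V ν y')⁻¹ (Φ y')))‖
      ≤ ρ ^ 2 * ‖R (V ν y * V μ (T ν y)) (R (V ν y')⁻¹ (Φ y')) - R (V μ y * V ν y') (R (V ν y')⁻¹ (Φ y'))‖ :=
        B9Eq371Composition.norm_R_le_sq (V ν y)⁻¹ (hρ ν y).2 (by rw [inv_inv]; exact (hρ ν y).1) _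
    _ ≤ ρ ^ 2 * (cP * (η * (g.len (blk y))⁻¹) ^ 2 * (ρ ^ 2 * ‖Φ y'‖)) :=
        mul_le_mul_of_nonneg_left (hp.trans (mul_le_mul_of_nonneg_left hQ (by positivity))) (pow_nonneg hρ0 _)
    _ = _ := by ring

variable [Fintype g.Site] {Rr : ℝ} {H : Prop}

omit [CompleteSpace 𝔸] in
/-- ★ **`η⁻¹[τ_μ, τ*_ν]`-SIZED LETTERS ARE BLOCK-`ℓ²` LETTERS OF WEIGHT `ηℓ⁻²`**: a one-neighbour letter `L` (reading `x + e_μ − e_ν`) with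
`‖(LΦ)(x)‖ = η⁻¹‖([τ_μ, τ*_ν]Φ)(x)‖`, under commuting shifts, transports `≦ ρ`, the plaquette smallness `c_P` at every point, the one-step backward scale
comparability `ℓ(y(x−e_ν))⁻² ≦ σ₁ℓ(y(x))⁻²` and the stencil bound `d₀`:
`conj b L ≺₂ ρ⁴c_Pσ₁·ηℓ(y)⁻²·M₂(Σ‖b_i‖)√|ι|·e^{2δd₀}·e^{−δd(y,y′)}`. [cite: Balaban1985BackgroundPropagators, p.398 (first remark), p.404 after (3.69); Balaban1984PropagatorsII, Prop. 2.6 (2.140) p.247] -/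
theorem hasL2Majorant_of_comm_shift (blk : S → g.Site) {η ρ cP σ₁ : ℝ} (hη : 0 < η) (hcP : 0 ≤ cP) (hσ₁ : 0 ≤ σ₁) (d₀ δ M₂ : ℝ)
    (hδ : 0 ≤ δ) (hM₂ : 0 ≤ M₂) (hrepr : ∀ (v : 𝔸) (i : ι), |b.repr v i| ≤ M₂ * ‖v‖) (μ ν : κ)
    (hcomm : ∀ x, T μ (T ν x) = T ν (T μ x))
    (hρ : ∀ κ' y, ‖((V κ' y : 𝔸ˣ) : 𝔸)‖ ≤ ρ ∧ ‖(((V κ' y)⁻¹ : 𝔸ˣ) : 𝔸)‖ ≤ ρ)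
    (hplaq : ∀ (x : S) (X : 𝔸), ‖R (V μ x * V ν (T μ x)) X - R (V ν x * V μ (T ν x)) X‖ ≤ cP * (η * (g.len (blk x))⁻¹) ^ 2 * ‖X‖)
    (hlen : ∀ y : g.Site, 0 < g.len y) (htri : ∀ a b c : g.Site, g.dist a c ≤ g.dist a b + g.dist b c)
    (hd₀ : ∀ κ' x, g.dist (blk x) (blk (T κ' x)) ≤ d₀ ∧ g.dist (blk x) (blk ((T κ').symm x)) ≤ d₀)
    (hσ : ∀ x, (g.len (blk ((T ν).symm x)))⁻¹ ^ 2 ≤ σ₁ * (g.len (blk x))⁻¹ ^ 2)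
    (L : Module.End ℝ (S → 𝔸))
    (hL : ∀ (Φ : S → 𝔸) (x : S), ‖L Φ x‖ = η⁻¹ * ‖(shiftFLetter T V μ * shiftBLetter T V ν - shiftBLetter T V ν * shiftFLetter T V μ) Φ x‖) :
    HasL2Majorant (g := toB6 g Rr H) (fun p : S × ι => blk p.1) (conj b L)
      (fun y y' => ((ρ ^ 4 * cP * σ₁ * (η * (g.len y)⁻¹ ^ 2)) * M₂ * (∑ i, ‖b i‖) * Real.sqrt (Fintype.card ι) * Real.exp (δ * (2 * d₀)))
        * Real.exp (-(δ * g.dist y y'))) := by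
  have hcomm' : ∀ x, T μ ((T ν).symm x) = (T ν).symm (T μ x) := fun x => by
    rw [Equiv.eq_symm_apply, ← hcomm, Equiv.apply_symm_apply]
  refine hasL2Majorant_conj_of_oneNeighbour_w b (Rr := Rr) (H := H) blk (fun x => (T ν).symm (T μ x)) ?_
    (fun y => ρ ^ 4 * cP * σ₁ * (η * (g.len y)⁻¹ ^ 2)) (2 * d₀) δ M₂ (fun y => ?_) hδ hM₂ hrepr (fun x => ?_) L (fun Φ x => ?_)
  · exact fun x x' h => (T μ).injective ((T ν).symm.injective h)
  · have := hlen y; positivity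
  · calc g.dist (blk x) (blk ((T ν).symm (T μ x))) ≤ g.dist (blk x) (blk (T μ x)) + g.dist (blk (T μ x)) (blk ((T ν).symm (T μ x))) := htri _ _ _
      _ ≤ d₀ + d₀ := add_le_add (hd₀ μ x).1 (hd₀ ν (T μ x)).2
      _ = 2 * d₀ := by ring
  · rw [hL]
    have h := norm_comm_shift_apply_le T V blk hcP μ ν x (hcomm' x) hρ (fun X => hplaq _ X) Φ
    have hℓ := hσ x
    have h0 : 0 ≤ ρ ^ 4 * cP * ‖Φ ((T ν).symm (T μ x))‖ := by positivity
    calc η⁻¹ * ‖(shiftFLetter T V μ * shiftBLetter T V ν - shiftBLetter T V ν * shiftFLetter T V μ) Φ x‖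
        ≤ η⁻¹ * (ρ ^ 4 * (cP * (η * (g.len (blk ((T ν).symm x)))⁻¹) ^ 2) * ‖Φ ((T ν).symm (T μ x))‖) :=
          mul_le_mul_of_nonneg_left h (inv_nonneg.mpr hη.le)
      _ = (η⁻¹ * η) * η * (g.len (blk ((T ν).symm x)))⁻¹ ^ 2 * (ρ ^ 4 * cP * ‖Φ ((T ν).symm (T μ x))‖) := by ring
      _ ≤ (η⁻¹ * η) * η * (σ₁ * (g.len (blk x))⁻¹ ^ 2) * (ρ ^ 4 * cP * ‖Φ ((T ν).symm (T μ x))‖) := by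
          refine mul_le_mul_of_nonneg_right (mul_le_mul_of_nonneg_left hℓ ?_) h0
          rw [inv_mul_cancel₀ hη.ne', one_mul]; exact hη.le
      _ = _ := by rw [inv_mul_cancel₀ hη.ne']; ring

omit [CompleteSpace 𝔸] in
/-- ★ `conj b [∇♯_{inl μ}, τ*_ν] ≺₂ ρ⁴c_Pσ₁·ηℓ⁻²·M₂(Σ‖b_i‖)√|ι|·e^{2δd₀}·e^{−δd}`. [cite: Balaban1985BackgroundPropagators, p.398 (first remark), (3.3) p.390, (3.5) p.391; Balaban1984PropagatorsII, Prop. 2.6 (2.140) p.247] -/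
theorem hasL2Majorant_comm_diffLetter_inl_shiftB (blk : S → g.Site) {η ρ cP σ₁ : ℝ} (hη : 0 < η) (hcP : 0 ≤ cP) (hσ₁ : 0 ≤ σ₁)
    (d₀ δ M₂ : ℝ) (hδ : 0 ≤ δ) (hM₂ : 0 ≤ M₂) (hrepr : ∀ (v : 𝔸) (i : ι), |b.repr v i| ≤ M₂ * ‖v‖) (μ ν : κ)
    (hcomm : ∀ x, T μ (T ν x) = T ν (T μ x))
    (hρ : ∀ κ' y, ‖((V κ' y : 𝔸ˣ) : 𝔸)‖ ≤ ρ ∧ ‖(((V κ' y)⁻¹ : 𝔸ˣ) : 𝔸)‖ ≤ ρ)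
    (hplaq : ∀ (x : S) (X : 𝔸), ‖R (V μ x * V ν (T μ x)) X - R (V ν x * V μ (T ν x)) X‖ ≤ cP * (η * (g.len (blk x))⁻¹) ^ 2 * ‖X‖)
    (hlen : ∀ y : g.Site, 0 < g.len y) (htri : ∀ a b c : g.Site, g.dist a c ≤ g.dist a b + g.dist b c)
    (hd₀ : ∀ κ' x, g.dist (blk x) (blk (T κ' x)) ≤ d₀ ∧ g.dist (blk x) (blk ((T κ').symm x)) ≤ d₀)
    (hσ : ∀ x, (g.len (blk ((T ν).symm x)))⁻¹ ^ 2 ≤ σ₁ * (g.len (blk x))⁻¹ ^ 2) :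
    HasL2Majorant (g := toB6 g Rr H) (fun p : S × ι => blk p.1)
      (conj b (diffLetter T V (((η : ℂ))⁻¹) (Sum.inl μ) * shiftBLetter T V ν - shiftBLetter T V ν * diffLetter T V (((η : ℂ))⁻¹) (Sum.inl μ)))
      (fun y y' => ((ρ ^ 4 * cP * σ₁ * (η * (g.len y)⁻¹ ^ 2)) * M₂ * (∑ i, ‖b i‖) * Real.sqrt (Fintype.card ι) * Real.exp (δ * (2 * d₀)))
        * Real.exp (-(δ * g.dist y y'))) :=
  hasL2Majorant_of_comm_shift b T V (Rr := Rr) (H := H) blk hη hcP hσ₁ d₀ δ M₂ hδ hM₂ hrepr μ ν hcomm hρ hplaq hlen htri hd₀ hσ _ fun Φ x => by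
    rw [comm_diffLetter_inl_shiftB_apply, norm_inv_smul' hη]

omit [CompleteSpace 𝔸] in
/-- ★ `conj b [τ_μ, ∇♯_{inr ν}] ≺₂ ρ⁴c_Pσ₁·ηℓ⁻²·M₂(Σ‖b_i‖)√|ι|·e^{2δd₀}·e^{−δd}`. [cite: Balaban1985BackgroundPropagators, p.398 (first remark), (3.8) p.392, (3.5) p.391; Balaban1984PropagatorsII, Prop. 2.6 (2.140) p.247] -/
theorem hasL2Majorant_comm_shiftF_diffLetter_inr (blk : S → g.Site) {η ρ cP σ₁ : ℝ} (hη : 0 < η) (hcP : 0 ≤ cP) (hσ₁ : 0 ≤ σ₁)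
    (d₀ δ M₂ : ℝ) (hδ : 0 ≤ δ) (hM₂ : 0 ≤ M₂) (hrepr : ∀ (v : 𝔸) (i : ι), |b.repr v i| ≤ M₂ * ‖v‖) (μ ν : κ)
    (hcomm : ∀ x, T μ (T ν x) = T ν (T μ x))
    (hρ : ∀ κ' y, ‖((V κ' y : 𝔸ˣ) : 𝔸)‖ ≤ ρ ∧ ‖(((V κ' y)⁻¹ : 𝔸ˣ) : 𝔸)‖ ≤ ρ)
    (hplaq : ∀ (x : S) (X : 𝔸), ‖R (V μ x * V ν (T μ x)) X - R (V ν x * V μ (T ν x)) X‖ ≤ cP * (η * (g.len (blk x))⁻¹) ^ 2 * ‖X‖)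
    (hlen : ∀ y : g.Site, 0 < g.len y) (htri : ∀ a b c : g.Site, g.dist a c ≤ g.dist a b + g.dist b c)
    (hd₀ : ∀ κ' x, g.dist (blk x) (blk (T κ' x)) ≤ d₀ ∧ g.dist (blk x) (blk ((T κ').symm x)) ≤ d₀)
    (hσ : ∀ x, (g.len (blk ((T ν).symm x)))⁻¹ ^ 2 ≤ σ₁ * (g.len (blk x))⁻¹ ^ 2) :
    HasL2Majorant (g := toB6 g Rr H) (fun p : S × ι => blk p.1)
      (conj b (shiftFLetter T V μ * diffLetter T V (((η : ℂ))⁻¹) (Sum.inr ν) - diffLetter T V (((η : ℂ))⁻¹) (Sum.inr ν) * shiftFLetter T V μ))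
      (fun y y' => ((ρ ^ 4 * cP * σ₁ * (η * (g.len y)⁻¹ ^ 2)) * M₂ * (∑ i, ‖b i‖) * Real.sqrt (Fintype.card ι) * Real.exp (δ * (2 * d₀)))
        * Real.exp (-(δ * g.dist y y'))) :=
  hasL2Majorant_of_comm_shift b T V (Rr := Rr) (H := H) blk hη hcP hσ₁ d₀ δ M₂ hδ hM₂ hrepr μ ν hcomm hρ hplaq hlen htri hd₀ hσ _ fun Φ x => by
    rw [comm_shiftF_diffLetter_inr_apply, norm_neg, norm_inv_smul' hη]

end Commutator

/-! ## §2  ★★ The two INNER orientation switches composed with the (3.46) entries of `Gp` -/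

section Inner

variable {𝔸 : Type*} [NormedRing 𝔸] [NormedAlgebra ℂ 𝔸] [CompleteSpace 𝔸] {ι : Type} [Fintype ι] [DecidableEq ι]
variable (b : Module.Basis ι ℝ 𝔸) {S : Type} [Fintype S] [DecidableEq S] {κ : Type}
variable (T : κ → Equiv.Perm S) (V : κ → S → 𝔸ˣ)
variable {g : B9.Geometry} [Fintype g.Site] {Rr : ℝ} {H : Prop}

omit [Fintype g.Site] in
/-- the constant weight transfers with constant `1` (`αδ₀ ≧ 0`, distances `≧ 0`). [cite: Balaban1985BackgroundPropagators, (3.47) p.398, bookkeeping] -/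
theorem scaleTransfer_one {δ₀ α : ℝ} (hαδ : 0 ≤ α * δ₀) (hdnn : ∀ a a' : g.Site, 0 ≤ g.dist a a') : ScaleTransfer g δ₀ α 1 (fun _ => (1 : ℝ)) := by
  intro y y'
  rw [mul_one, mul_one, Real.exp_le_one_iff]
  have := hdnn y y'
  nlinarith

omit [CompleteSpace 𝔸] in
/-- ★★ **THE INNER LEFT SWITCH `∇♯_{inl μ}∇♯_{inl ν}·Gp ↦ ∇♯_{inl μ}∇♯_{inr ν}·Gp`** (p. 398 first remark, for the member `∇∇G` of (3.46)): if
`∇♯_{inl μ}∇♯_{inl ν}·Gp ≺₂ B·e^{−δd}` and `∇♯_{inl ν}·Gp ≺₂ Bℓ·e^{−δd}`, then under transports `≦ ρ`, commuting shifts, the plaquette smallness `c_P`, the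
one-step scale comparability `σ₁`, `η ≦ ℓ`, the stencil geometry, the transfers of `1` (`Λ₀`) and `ℓ` (`Λ₁`) at exponent `α` and (2.61) at `β`, for `r ≧ 0` with
`r + (α+β)δ₀ ≦ δ`: `∇♯_{inl μ}∇♯_{inr ν}·Gp ≺₂ (c₁M₂(Σ‖b_i‖)√|ι|·(ρ²e^{δd₀}Λ₀ + ρ⁴c_Pσ₁e^{2δd₀}Λ₁))·B·e^{−rd}` — from
`∇_μ∇*_ν = τ*_ν∇_μ∇_ν + [∇_μ, τ*_ν]∇_ν` and [4] (2.141).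
[cite: Balaban1985BackgroundPropagators, p.398 (first remark), (3.8) p.392, (3.46) p.398; Balaban1984PropagatorsII, Prop. 2.6 (2.140)–(2.141) p.247, Lemma 2.1 p.234] -/
theorem hasL2Majorant_cross2_left_inner (blk : S → g.Site) (d : ℕ) {η : ℝ} (hη : 0 < η) (ρ cP σ₁ d₀ M₂ δ₀ δ α β r Λ₀ Λ₁ B : ℝ)
    (hcP : 0 ≤ cP) (hσ₁ : 0 ≤ σ₁) (hδ : 0 ≤ δ) (hM₂ : 0 ≤ M₂) (hB : 0 ≤ B) (hΛ₀ : 0 ≤ Λ₀) (hΛ₁ : 0 ≤ Λ₁) (hr : 0 ≤ r)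
    (hrδ : r + (α + β) * δ₀ ≤ δ) (hrle : r ≤ δ) (hrepr : ∀ (v : 𝔸) (i : ι), |b.repr v i| ≤ M₂ * ‖v‖)
    (hdnn : ∀ a a' : g.Site, 0 ≤ g.dist a a') (htri : Triangle254 (toB6 g Rr H)) (hlen : ∀ y : g.Site, 0 < g.len y)
    (h261 : Ineq261 d (toB6 g Rr H) δ₀ β) (hT0 : ScaleTransfer g δ₀ α Λ₀ (fun _ => (1 : ℝ))) (hT1 : ScaleTransfer g δ₀ α Λ₁ (fun a => g.len a))
    (μ ν : κ) (hcomm : ∀ x, T μ (T ν x) = T ν (T μ x))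
    (hρ : ∀ κ' y, ‖((V κ' y : 𝔸ˣ) : 𝔸)‖ ≤ ρ ∧ ‖(((V κ' y)⁻¹ : 𝔸ˣ) : 𝔸)‖ ≤ ρ)
    (hplaq : ∀ (x : S) (X : 𝔸), ‖R (V μ x * V ν (T μ x)) X - R (V ν x * V μ (T ν x)) X‖ ≤ cP * (η * (g.len (blk x))⁻¹) ^ 2 * ‖X‖)
    (hd₀ : ∀ κ' x, g.dist (blk x) (blk (T κ' x)) ≤ d₀ ∧ g.dist (blk x) (blk ((T κ').symm x)) ≤ d₀)
    (hσ : ∀ x, (g.len (blk ((T ν).symm x)))⁻¹ ^ 2 ≤ σ₁ * (g.len (blk x))⁻¹ ^ 2) (heta : ∀ y : g.Site, η ≤ g.len y)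
    {Gp : Module.End ℝ (S × ι → ℝ)}
    (hDD : HasL2Majorant (g := toB6 g Rr H) (fun p : S × ι => blk p.1)
      (conj b (diffLetter T V (((η : ℂ))⁻¹) (Sum.inl μ)) * conj b (diffLetter T V (((η : ℂ))⁻¹) (Sum.inl ν)) * Gp)
      (fun a a' => B * 1 * Real.exp (-(δ * g.dist a a'))))
    (hD : HasL2Majorant (g := toB6 g Rr H) (fun p : S × ι => blk p.1) (conj b (diffLetter T V (((η : ℂ))⁻¹) (Sum.inl ν)) * Gp)
      (fun a a' => B * g.len a * Real.exp (-(δ * g.dist a a')))) :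
    HasL2Majorant (g := toB6 g Rr H) (fun p : S × ι => blk p.1)
      (conj b (diffLetter T V (((η : ℂ))⁻¹) (Sum.inl μ)) * conj b (diffLetter T V (((η : ℂ))⁻¹) (Sum.inr ν)) * Gp)
      (fun a a' => ((B6.c1 d δ₀ β * M₂ * (∑ i, ‖b i‖) * Real.sqrt (Fintype.card ι)
          * (ρ ^ 2 * Real.exp (δ * d₀) * Λ₀ + ρ ^ 4 * cP * σ₁ * Real.exp (δ * (2 * d₀)) * Λ₁)) * B) * 1 * Real.exp (-(r * g.dist a a'))) := by
  set c : ℂ := ((η : ℂ))⁻¹ with hc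
  set Dμ := diffLetter T V c (Sum.inl μ) with hDμ
  set Dν := diffLetter T V c (Sum.inl ν) with hDν
  set Sν := shiftBLetter T V ν with hSν
  set Sb : ℝ := ∑ i, ‖b i‖ with hSb
  set sι : ℝ := Real.sqrt (Fintype.card ι) with hsι
  have hSb0 : 0 ≤ Sb := Finset.sum_nonneg fun i _ => norm_nonneg _
  have hsι0 : 0 ≤ sι := Real.sqrt_nonneg _
  have hc10 : 0 ≤ B6.c1 d δ₀ β := B6RandomWalk.c1_nonneg d δ₀ β
  have hw1 : ∀ a : g.Site, 0 ≤ g.len a := fun a => (hlen a).le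
  have hwi2 : ∀ a : g.Site, 0 ≤ η * (g.len a)⁻¹ ^ 2 := fun a => mul_nonneg hη.le (pow_nonneg (inv_nonneg.mpr (hlen a).le) _)
  have htri' : ∀ a b c : g.Site, g.dist a c ≤ g.dist a b + g.dist b c := fun a b c => htri a b c
  -- the two local letters at rate `δ`
  have hS := hasL2Majorant_shiftBLetter b T V (Rr := Rr) (H := H) blk ρ d₀ δ M₂ hδ hM₂ hrepr hρ (fun κ' x => (hd₀ κ' x).2) ν
  have hC := hasL2Majorant_comm_diffLetter_inl_shiftB b T V (Rr := Rr) (H := H) blk hη hcP hσ₁ d₀ δ M₂ hδ hM₂ hrepr μ ν hcomm hρ hplaq hlen htri' hd₀ hσ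
  -- the entries at the output rate
  have hDDr : HasL2Majorant (g := toB6 g Rr H) (fun p : S × ι => blk p.1) (conj b Dμ * conj b Dν * Gp) (fun a a' => B * 1 * Real.exp (-(r * g.dist a a'))) :=
    hasL2Majorant_rate_mono (R := Rr) (H := H) _ B (fun _ => 1) hB (fun _ => zero_le_one) hrle hdnn hDD
  have hDr : HasL2Majorant (g := toB6 g Rr H) (fun p : S × ι => blk p.1) (conj b Dν * Gp) (fun a a' => B * g.len a * Real.exp (-(r * g.dist a a'))) :=
    hasL2Majorant_rate_mono (R := Rr) (H := H) _ B (fun a => g.len a) hB hw1 hrle hdnn hD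
  -- (T1) `τ*_ν·(∇_μ∇_ν·Gp)`
  have hP1 := hasL2Majorant_comp_decay (R := Rr) (H := H) (fun p : S × ι => blk p.1) d δ₀ α β r δ Λ₀ (ρ ^ 2 * M₂ * Sb * sι * Real.exp (δ * d₀)) B
    (fun _ => (1 : ℝ)) (fun _ => (1 : ℝ)) (fun _ => zero_le_one) (fun _ => zero_le_one) hΛ₀ (by positivity) hB hr hrδ hdnn htri hT0 h261
    (hasL2Majorant_mono (g := toB6 g Rr H) _ hS fun a a' => le_of_eq (by ring)) hDDr
  -- (T2) `[∇_μ, τ*_ν]·(∇_ν·Gp)`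
  have hP2 := hasL2Majorant_comp_decay (R := Rr) (H := H) (fun p : S × ι => blk p.1) d δ₀ α β r δ Λ₁
    (ρ ^ 4 * cP * σ₁ * M₂ * Sb * sι * Real.exp (δ * (2 * d₀))) B (fun a => η * (g.len a)⁻¹ ^ 2) (fun a => g.len a) hwi2 hw1 hΛ₁ (by positivity) hB
    hr hrδ hdnn htri hT1 h261 (hasL2Majorant_mono (g := toB6 g Rr H) _ hC fun a a' => le_of_eq (by ring)) hDr
  -- `∇_μ∇*_ν·Gp = τ*_ν·(∇_μ∇_ν·Gp) + [∇_μ, τ*_ν]·(∇_ν·Gp)`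
  have hsplit : conj b Dμ * conj b (diffLetter T V c (Sum.inr ν)) * Gp
      = conj b Sν * (conj b Dμ * conj b Dν * Gp) + conj b (Dμ * Sν - Sν * Dμ) * (conj b Dν * Gp) := by
    rw [diffLetter_inr_eq_shiftB_mul]
    simp only [conj_sub, B9Eq352DivFormLetters.conj_mul, sub_mul, mul_assoc]
    abel
  rw [hsplit]
  refine hasL2Majorant_mono (g := toB6 g Rr H) _ (hasL2Majorant_add (g := toB6 g Rr H) _ hP1 hP2) fun (a : g.Site) (a' : g.Site) => ?_
  have hex : 0 ≤ Real.exp (-(r * g.dist a a')) := (Real.exp_pos _).le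
  have hηℓ : η * (g.len a)⁻¹ ^ 2 * g.len a ≤ 1 := by
    have e : η * (g.len a)⁻¹ ^ 2 * g.len a = η * (g.len a)⁻¹ := by
      rw [pow_two, mul_assoc, mul_assoc, inv_mul_cancel₀ (hlen a).ne', mul_one]
    rw [e, mul_inv_le_iff₀ (hlen a), one_mul]
    exact heta a
  have hK2 : 0 ≤ ρ ^ 4 * cP * σ₁ * M₂ * Sb * sι * Real.exp (δ * (2 * d₀)) * B * Λ₁ * B6.c1 d δ₀ β := by positivity
  calc ρ ^ 2 * M₂ * Sb * sι * Real.exp (δ * d₀) * B * Λ₀ * B6.c1 d δ₀ β * (1 * 1) * Real.exp (-(r * g.dist a a'))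
        + ρ ^ 4 * cP * σ₁ * M₂ * Sb * sι * Real.exp (δ * (2 * d₀)) * B * Λ₁ * B6.c1 d δ₀ β * (η * (g.len a)⁻¹ ^ 2 * g.len a)
          * Real.exp (-(r * g.dist a a'))
      ≤ ρ ^ 2 * M₂ * Sb * sι * Real.exp (δ * d₀) * B * Λ₀ * B6.c1 d δ₀ β * (1 * 1) * Real.exp (-(r * g.dist a a'))
        + ρ ^ 4 * cP * σ₁ * M₂ * Sb * sι * Real.exp (δ * (2 * d₀)) * B * Λ₁ * B6.c1 d δ₀ β * 1 * Real.exp (-(r * g.dist a a')) := by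
        have := mul_le_mul_of_nonneg_left hηℓ hK2
        nlinarith [mul_le_mul_of_nonneg_right this hex]
    _ = _ := by ring

omit [CompleteSpace 𝔸] in
/-- ★★ **THE INNER RIGHT SWITCH `Gp·∇♯_{inr μ}∇♯_{inr ν} ↦ Gp·∇♯_{inl μ}∇♯_{inr ν}`** (p. 398 first remark, for the member `G∇*∇*` of (3.46)): if
`Gp·∇♯_{inr μ}∇♯_{inr ν} ≺₂ B·e^{−δd}` and `Gp·∇♯_{inr μ} ≺₂ Bℓ·e^{−δd}`, then under transports `≦ ρ`, commuting shifts, the plaquette smallness `c_P`, the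
one-step scale comparability `σ₁`, `η ≦ ℓ`, the stencil geometry, the transfers of `1` (`Λ₀`) and `ℓ⁻²` (`Λ₂`) at exponent `α` and (2.61) at `β`, for `r ≧ 0` with
`r + (α+β)δ₀ ≦ δ`: `Gp·∇♯_{inl μ}∇♯_{inr ν} ≺₂ (c₁M₂(Σ‖b_i‖)√|ι|·(ρ²e^{rd₀}Λ₀ + ρ⁴c_Pσ₁e^{2rd₀}Λ₂))·B·e^{−rd}` — from
`∇_μ∇*_ν = ∇*_μτ_μ∇*_ν = ∇*_μ∇*_ντ_μ + ∇*_μ[τ_μ, ∇*_ν]` and [4] (2.141).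
[cite: Balaban1985BackgroundPropagators, p.398 (first remark), (3.8) p.392, (3.46) p.398; Balaban1984PropagatorsII, Prop. 2.6 (2.140)–(2.141) p.247, Lemma 2.1 p.234] -/
theorem hasL2Majorant_cross2_right_inner (blk : S → g.Site) (d : ℕ) {η : ℝ} (hη : 0 < η) (ρ cP σ₁ d₀ M₂ δ₀ δ α β r Λ₀ Λ₂ B : ℝ)
    (hcP : 0 ≤ cP) (hσ₁ : 0 ≤ σ₁) (hM₂ : 0 ≤ M₂) (hB : 0 ≤ B) (hΛ₀ : 0 ≤ Λ₀) (hΛ₂ : 0 ≤ Λ₂) (hr : 0 ≤ r)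
    (hrδ : r + (α + β) * δ₀ ≤ δ) (hrepr : ∀ (v : 𝔸) (i : ι), |b.repr v i| ≤ M₂ * ‖v‖)
    (hdnn : ∀ a a' : g.Site, 0 ≤ g.dist a a') (htri : Triangle254 (toB6 g Rr H)) (hlen : ∀ y : g.Site, 0 < g.len y)
    (h261 : Ineq261 d (toB6 g Rr H) δ₀ β) (hT0 : ScaleTransfer g δ₀ α Λ₀ (fun _ => (1 : ℝ)))
    (hTi2 : ScaleTransfer g δ₀ α Λ₂ (fun a => (g.len a)⁻¹ ^ 2))
    (μ ν : κ) (hcomm : ∀ x, T μ (T ν x) = T ν (T μ x))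
    (hρ : ∀ κ' y, ‖((V κ' y : 𝔸ˣ) : 𝔸)‖ ≤ ρ ∧ ‖(((V κ' y)⁻¹ : 𝔸ˣ) : 𝔸)‖ ≤ ρ)
    (hplaq : ∀ (x : S) (X : 𝔸), ‖R (V μ x * V ν (T μ x)) X - R (V ν x * V μ (T ν x)) X‖ ≤ cP * (η * (g.len (blk x))⁻¹) ^ 2 * ‖X‖)
    (hd₀ : ∀ κ' x, g.dist (blk x) (blk (T κ' x)) ≤ d₀ ∧ g.dist (blk x) (blk ((T κ').symm x)) ≤ d₀)
    (hσ : ∀ x, (g.len (blk ((T ν).symm x)))⁻¹ ^ 2 ≤ σ₁ * (g.len (blk x))⁻¹ ^ 2) (heta : ∀ y : g.Site, η ≤ g.len y)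
    {Gp : Module.End ℝ (S × ι → ℝ)}
    (hDD : HasL2Majorant (g := toB6 g Rr H) (fun p : S × ι => blk p.1)
      (Gp * conj b (diffLetter T V (((η : ℂ))⁻¹) (Sum.inr μ)) * conj b (diffLetter T V (((η : ℂ))⁻¹) (Sum.inr ν)))
      (fun a a' => B * 1 * Real.exp (-(δ * g.dist a a'))))
    (hD : HasL2Majorant (g := toB6 g Rr H) (fun p : S × ι => blk p.1) (Gp * conj b (diffLetter T V (((η : ℂ))⁻¹) (Sum.inr μ)))
      (fun a a' => B * g.len a * Real.exp (-(δ * g.dist a a')))) :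
    HasL2Majorant (g := toB6 g Rr H) (fun p : S × ι => blk p.1)
      (Gp * conj b (diffLetter T V (((η : ℂ))⁻¹) (Sum.inl μ)) * conj b (diffLetter T V (((η : ℂ))⁻¹) (Sum.inr ν)))
      (fun a a' => ((B6.c1 d δ₀ β * M₂ * (∑ i, ‖b i‖) * Real.sqrt (Fintype.card ι)
          * (ρ ^ 2 * Real.exp (r * d₀) * Λ₀ + ρ ^ 4 * cP * σ₁ * Real.exp (r * (2 * d₀)) * Λ₂)) * B) * 1 * Real.exp (-(r * g.dist a a'))) := by
  set c : ℂ := ((η : ℂ))⁻¹ with hc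
  set Dμ := diffLetter T V c (Sum.inr μ) with hDμ
  set Dν := diffLetter T V c (Sum.inr ν) with hDν
  set Tμ := shiftFLetter T V μ with hTμ
  set Sb : ℝ := ∑ i, ‖b i‖ with hSb
  set sι : ℝ := Real.sqrt (Fintype.card ι) with hsι
  have hSb0 : 0 ≤ Sb := Finset.sum_nonneg fun i _ => norm_nonneg _
  have hsι0 : 0 ≤ sι := Real.sqrt_nonneg _
  have hc10 : 0 ≤ B6.c1 d δ₀ β := B6RandomWalk.c1_nonneg d δ₀ β
  have hw1 : ∀ a : g.Site, 0 ≤ g.len a := fun a => (hlen a).le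
  have hwi2 : ∀ a : g.Site, 0 ≤ (g.len a)⁻¹ ^ 2 := fun a => pow_nonneg (inv_nonneg.mpr (hlen a).le) _
  have htri' : ∀ a b c : g.Site, g.dist a c ≤ g.dist a b + g.dist b c := fun a b c => htri a b c
  -- the two local letters at the output rate `r`
  have hS := hasL2Majorant_shiftFLetter b T V (Rr := Rr) (H := H) blk ρ d₀ r M₂ hr hM₂ hrepr hρ (fun κ' x => (hd₀ κ' x).1) μ
  have hC := hasL2Majorant_comm_shiftF_diffLetter_inr b T V (Rr := Rr) (H := H) blk hη hcP hσ₁ d₀ r M₂ hr hM₂ hrepr μ ν hcomm hρ hplaq hlen htri' hd₀ hσ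
  -- (T1') `(Gp·∇*_μ∇*_ν)·τ_μ`
  have hP1 := hasL2Majorant_comp_decay (R := Rr) (H := H) (fun p : S × ι => blk p.1) d δ₀ α β r δ Λ₀ B (ρ ^ 2 * M₂ * Sb * sι * Real.exp (r * d₀))
    (fun _ => (1 : ℝ)) (fun _ => (1 : ℝ)) (fun _ => zero_le_one) (fun _ => zero_le_one) hΛ₀ hB (by positivity) hr hrδ hdnn htri hT0 h261 hDD
    (hasL2Majorant_mono (g := toB6 g Rr H) _ hS fun a a' => le_of_eq (by ring))
  -- (T2') `(Gp·∇*_μ)·[τ_μ, ∇*_ν]`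
  have hP2 := hasL2Majorant_comp_decay (R := Rr) (H := H) (fun p : S × ι => blk p.1) d δ₀ α β r δ Λ₂ B
    (ρ ^ 4 * cP * σ₁ * η * M₂ * Sb * sι * Real.exp (r * (2 * d₀))) (fun a => g.len a) (fun a => (g.len a)⁻¹ ^ 2) hw1 hwi2 hΛ₂ hB (by positivity)
    hr hrδ hdnn htri hTi2 h261 hD (hasL2Majorant_mono (g := toB6 g Rr H) _ hC fun a a' => le_of_eq (by ring))
  -- `Gp·∇_μ∇*_ν = (Gp·∇*_μ∇*_ν)·τ_μ + (Gp·∇*_μ)·[τ_μ, ∇*_ν]`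
  have hsplit : Gp * conj b (diffLetter T V c (Sum.inl μ)) * conj b Dν
      = Gp * conj b Dμ * conj b Dν * conj b Tμ + Gp * conj b Dμ * conj b (Tμ * Dν - Dν * Tμ) := by
    rw [diffLetter_inl_eq_mul_shiftF]
    simp only [conj_sub, B9Eq352DivFormLetters.conj_mul, mul_sub, mul_assoc]
    abel
  rw [hsplit]
  refine hasL2Majorant_mono (g := toB6 g Rr H) _ (hasL2Majorant_add (g := toB6 g Rr H) _ hP1 hP2) fun (a : g.Site) (a' : g.Site) => ?_
  have hex : 0 ≤ Real.exp (-(r * g.dist a a')) := (Real.exp_pos _).le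
  have hηℓ : η * (g.len a * (g.len a)⁻¹ ^ 2) ≤ 1 := by
    have e : g.len a * (g.len a)⁻¹ ^ 2 = (g.len a)⁻¹ := by
      rw [pow_two, ← mul_assoc, mul_inv_cancel₀ (hlen a).ne', one_mul]
    rw [e, mul_inv_le_iff₀ (hlen a), one_mul]
    exact heta a
  have hK2 : 0 ≤ B * (ρ ^ 4 * cP * σ₁ * M₂ * Sb * sι * Real.exp (r * (2 * d₀))) * Λ₂ * B6.c1 d δ₀ β := by positivity
  calc B * (ρ ^ 2 * M₂ * Sb * sι * Real.exp (r * d₀)) * Λ₀ * B6.c1 d δ₀ β * (1 * 1) * Real.exp (-(r * g.dist a a'))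
        + B * (ρ ^ 4 * cP * σ₁ * η * M₂ * Sb * sι * Real.exp (r * (2 * d₀))) * Λ₂ * B6.c1 d δ₀ β * (g.len a * (g.len a)⁻¹ ^ 2)
          * Real.exp (-(r * g.dist a a'))
      = B * (ρ ^ 2 * M₂ * Sb * sι * Real.exp (r * d₀)) * Λ₀ * B6.c1 d δ₀ β * (1 * 1) * Real.exp (-(r * g.dist a a'))
        + B * (ρ ^ 4 * cP * σ₁ * M₂ * Sb * sι * Real.exp (r * (2 * d₀))) * Λ₂ * B6.c1 d δ₀ β * (η * (g.len a * (g.len a)⁻¹ ^ 2))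
          * Real.exp (-(r * g.dist a a')) := by ring
    _ ≤ B * (ρ ^ 2 * M₂ * Sb * sι * Real.exp (r * d₀)) * Λ₀ * B6.c1 d δ₀ β * (1 * 1) * Real.exp (-(r * g.dist a a'))
        + B * (ρ ^ 4 * cP * σ₁ * M₂ * Sb * sι * Real.exp (r * (2 * d₀))) * Λ₂ * B6.c1 d δ₀ β * 1 * Real.exp (-(r * g.dist a a')) := by
        have := mul_le_mul_of_nonneg_left hηℓ hK2
        nlinarith [mul_le_mul_of_nonneg_right this hex]
    _ = _ := by ring

end Inner

end Literature.MathematicalPhysics.QuantumFieldTheory.Balaban1983to89.B9Eq38SecondOrderCrossL2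

end
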